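import Summits.QuantumFields.YangMills.Theorems.IR.Negative.OuterCertInert

/-!
# The outer-tempered certificate with `δ`-uniform onset IS untempered strong mixing

Sequel to `OuterCertInert` (p476951) for crux `IR` (item stmt-QuantumFields-19354, skeleton v10 sha 88d42543849b7401,
open stub `stub_outerCert : IROuterCertificate`).  Kernel-checked, no `sorry`, standard axioms, no new definitions.

* `forall_outerTemperedCond_of_univShell` — the converse of inertness needs nothing: the untempered shell condition
  (body of seat 1's `UnivShellCond ρ β b n ε`) gives `OuterTemperedCond ρ β b n ε δ` for EVERY real `δ` with
  `Good ≡ univ` (seat 1's `univToOuter`, evidence #60, re-proved here against the tree copy of `OuterTemperedCond`).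
* `forall_outerTemperedCond_iff_univShell` — at fixed `(ρ, β, b, n, ε)`, for continuous `ρ` of a compact
  second-countable group: `(∀ δ > 0, OuterTemperedCond ρ β b n ε δ) ↔ UnivShellCond-body`.
* `uniformOuterCert_iff_eventually_univShell` — along ANY scale function `bf : ℝ → ℕ` (v10: `bf β = ⌈ℓ / a β⌉₊`):
  `(∃ β₂, ∀ β ≥ β₂, ∀ δ > 0, OuterTemperedCond ρ β (bf β) n ε δ) ↔ (∃ β₂, ∀ β ≥ β₂, UnivShellCond-body at bf β)`.
  The right side with v10's side conditions on `(ℓ, n, ε)` is seat 1's `PhysicalStrongMixing` conclusion.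
* `deltaFirst_of_uniformOuterCert` — the `δ`-uniform certificate trivially implies v10's `δ`-first order
  `∀ δ > 0, ∃ β₂, ∀ β ≥ β₂, …` (the order inside `OuterCertWire.OuterCertificate`).

Reading for the v10 / L3 decision (numbers, not adjectives): v10's `OuterCertificate` differs from plain physical
strong mixing by EXACTLY ONE quantifier swap — `∀ δ>0 ∃ β₂(δ)` (v10) versus `∃ β₂ ∀ δ>0` (≡ untempered, this file).
Everything tempering can buy is the freedom `β₂(δ) → ∞` as `δ → 0`, i.e. a positive floor `δ₀(β) > 0` on the rarity
of bad collar data at each fixed `β`.  Whether that floor is physically forced is what the film census (kit j262790)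
measures; the typed `CollarForcing` of card tempering-inert would be any hypothesis giving `β₂` independent of `δ`,
under which `stub_outerCert` is literally `PhysicalStrongMixing` (seat 1) by `uniformOuterCert_iff_eventually_univShell`.
-/

noncomputable section

open Filter Topology MeasureTheory
open Literature.MathematicalPhysics.QuantumFieldTheory Literature.MathematicalPhysics.QuantumLattice
open Literature.Probability.LatticeModels
open Summit.QuantumFields.YangMills.Cruxes.IR.Tempered (cellEdges windowCells regionEdges)
open Summit.QuantumFields.YangMills.Cruxes.IR.ShellTempered (windowCellsPlus)
open Summit.QuantumFields.YangMills.Cruxes.IR.OuterCertWire (OuterTemperedCond)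

namespace Summit.QuantumFields.YangMills.Cruxes.IR.OuterCertInert

variable {G : Type} [Group G] [TopologicalSpace G] [IsTopologicalGroup G] [CompactSpace G]
  [MeasurableSpace G] [BorelSpace G]

/-- **Untempered ⇒ tempered at every level** (`Good ≡ univ`; clause (ii) is `γ(∅) ≤ δ`).  No continuity, no sign
condition on `δ`. -/
theorem forall_outerTemperedCond_of_univShell {N : ℕ} (ρ : G →* Matrix (Fin N) (Fin N) ℂ) (β : ℝ) (b n : ℕ)
    (ε : ℝ)
    (hU : ∀ w : Fin 4 → ℤ → ℤ,
      (∀ i j, w i j + ((b : ℕ) : ℤ) ≤ w i (j + 1) ∧ w i (j + 1) ≤ w i j + 2 * ((b : ℕ) : ℤ)) →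
      ∀ Y : Finset (Fin 4 → ℤ), Y ⊆ windowCells n → (0 : Fin 4 → ℤ) ∈ Y →
        ∀ σ σ' : LGConfig 4 G,
          (∀ c ∈ windowCellsPlus n, c ∉ Y → c ∈ windowCells n → ∀ e ∈ cellEdges w c, σ e = σ' e) →
          ∀ f : LGConfig 4 G → ℝ, IsCylinder f (cellEdges w 0) → Measurable f → (∀ U, 0 ≤ f U ∧ f U ≤ 1) →
            |(∫ U, f U ∂(ymSpecification ρ β (regionEdges w Y) σ)) -
              ∫ U, f U ∂(ymSpecification ρ β (regionEdges w Y) σ')| ≤ ε)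
    (δ : ℝ) : OuterTemperedCond ρ β b n ε δ := by
  intro w hw
  refine ⟨fun _ => Set.univ, fun _ => MeasurableSet.univ, ?_, ?_, ?_⟩
  · intro c x y _
    simp
  · intro Y hY h0 σ σ' hpair f hf hfm hf01
    refine hU w hw Y hY h0 σ σ' ?_ f hf hfm hf01
    intro c hc hcY hcW e he
    rcases hpair c hc hcY with h | ⟨hnot, -, -⟩
    · exact h e he
    · exact absurd hcW hnot
  · intro c E' _ ζ
    simp

/-- **At fixed `(ρ, β, b, n, ε)` the all-`δ` tempered condition is the untempered one** (continuous `ρ`, compact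
second-countable `G`): `→` is `univShellCond_of_forall_outerTemperedCond` (p476951), `←` is `Good ≡ univ`. -/
theorem forall_outerTemperedCond_iff_univShell [SecondCountableTopology G] {N : ℕ}
    {ρ : G →* Matrix (Fin N) (Fin N) ℂ} (hρ : Continuous ρ) (β : ℝ) (b n : ℕ) (ε : ℝ) :
    (∀ δ : ℝ, 0 < δ → OuterTemperedCond ρ β b n ε δ) ↔
      ∀ w : Fin 4 → ℤ → ℤ,
        (∀ i j, w i j + ((b : ℕ) : ℤ) ≤ w i (j + 1) ∧ w i (j + 1) ≤ w i j + 2 * ((b : ℕ) : ℤ)) →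
        ∀ Y : Finset (Fin 4 → ℤ), Y ⊆ windowCells n → (0 : Fin 4 → ℤ) ∈ Y →
          ∀ σ σ' : LGConfig 4 G,
            (∀ c ∈ windowCellsPlus n, c ∉ Y → c ∈ windowCells n → ∀ e ∈ cellEdges w c, σ e = σ' e) →
            ∀ f : LGConfig 4 G → ℝ, IsCylinder f (cellEdges w 0) → Measurable f → (∀ U, 0 ≤ f U ∧ f U ≤ 1) →
              |(∫ U, f U ∂(ymSpecification ρ β (regionEdges w Y) σ)) -
                ∫ U, f U ∂(ymSpecification ρ β (regionEdges w Y) σ')| ≤ ε :=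
  ⟨fun h => univShellCond_of_forall_outerTemperedCond hρ h,
    fun hU δ _ => forall_outerTemperedCond_of_univShell ρ β b n ε hU δ⟩

/-- **`δ`-uniform onset ⇔ eventual untempered mixing**, along any scale function `bf` (v10: `bf β = ⌈ℓ / a β⌉₊`).
With v10's side conditions on `(ℓ, n, ε)` prefixed, the right-hand side is the conclusion of seat 1's
`PhysicalStrongMixing`; so a certificate whose `β₂` does not depend on `δ` is untempered strong mixing verbatim. -/
theorem uniformOuterCert_iff_eventually_univShell [SecondCountableTopology G] {N : ℕ}
    {ρ : G →* Matrix (Fin N) (Fin N) ℂ} (hρ : Continuous ρ) (bf : ℝ → ℕ) (n : ℕ) (ε : ℝ) :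
    (∃ β₂ : ℝ, ∀ β : ℝ, β₂ ≤ β → ∀ δ : ℝ, 0 < δ → OuterTemperedCond ρ β (bf β) n ε δ) ↔
      ∃ β₂ : ℝ, ∀ β : ℝ, β₂ ≤ β →
        ∀ w : Fin 4 → ℤ → ℤ,
          (∀ i j, w i j + ((bf β : ℕ) : ℤ) ≤ w i (j + 1) ∧ w i (j + 1) ≤ w i j + 2 * ((bf β : ℕ) : ℤ)) →
          ∀ Y : Finset (Fin 4 → ℤ), Y ⊆ windowCells n → (0 : Fin 4 → ℤ) ∈ Y →
            ∀ σ σ' : LGConfig 4 G,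
              (∀ c ∈ windowCellsPlus n, c ∉ Y → c ∈ windowCells n → ∀ e ∈ cellEdges w c, σ e = σ' e) →
              ∀ f : LGConfig 4 G → ℝ, IsCylinder f (cellEdges w 0) → Measurable f →
                (∀ U, 0 ≤ f U ∧ f U ≤ 1) →
                |(∫ U, f U ∂(ymSpecification ρ β (regionEdges w Y) σ)) -
                  ∫ U, f U ∂(ymSpecification ρ β (regionEdges w Y) σ')| ≤ ε := by
  constructor
  · rintro ⟨β₂, h⟩
    exact ⟨β₂, fun β hβ => (forall_outerTemperedCond_iff_univShell hρ β (bf β) n ε).1 (h β hβ)⟩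
  · rintro ⟨β₂, h⟩
    exact ⟨β₂, fun β hβ => (forall_outerTemperedCond_iff_univShell hρ β (bf β) n ε).2 (h β hβ)⟩

/-- **The `δ`-uniform certificate implies v10's `δ`-first one** (the quantifier order inside
`OuterCertWire.OuterCertificate`); the converse swap is exactly what tempering could buy and is NOT claimed. -/
theorem deltaFirst_of_uniformOuterCert {N : ℕ} (ρ : G →* Matrix (Fin N) (Fin N) ℂ) (bf : ℝ → ℕ) (n : ℕ)
    (ε : ℝ) (h : ∃ β₂ : ℝ, ∀ β : ℝ, β₂ ≤ β → ∀ δ : ℝ, 0 < δ → OuterTemperedCond ρ β (bf β) n ε δ) :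
    ∀ δ : ℝ, 0 < δ → ∃ β₂ : ℝ, ∀ β : ℝ, β₂ ≤ β → OuterTemperedCond ρ β (bf β) n ε δ := by
  obtain ⟨β₂, h⟩ := h
  exact fun δ hδ => ⟨β₂, fun β hβ => h β hβ δ hδ⟩

end Summit.QuantumFields.YangMills.Cruxes.IR.OuterCertInert
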